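import Summits.SmoothPoincare4.SmoothPoincare4.Theorems.InformationMetricHadamardAhHadamardFillingStubHellingerGaussEquationFamilies
import Summits.SmoothPoincare4.SmoothPoincare4.Theorems.InformationMetricHadamardAhHadamardFillingStubFisherRaoMetric

/-!
# A jointly smooth family of functions as a smooth map into `L²`
(crux `InformationMetricHadamard.AhHadamardFilling`, item stmt-SmoothPoincare4-6014, line `fisher-sphere-gauss`,
stub K2 `stub_hellingerGaussEquation` — the Gauss equation of the Hellinger map). The stub's proof
(`…StubHellingerGaussEquation.lean`) is split by topic into three helper files and the stub file
(tree rule: Theorems files ≤ 400 lines):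
1. `…StubHellingerGaussEquationFamilies.lean` — a jointly smooth family `f : P → K → ℝ` over a
   compact manifold `K` as a `C^∞` map `P → C(K, ℝ)` (differentiation uniformly in `x ∈ K`);
2. `…StubHellingerGaussEquationImmersion.lean` — the Gauss equation of an isometric immersion of a
   manifold into a flat real inner product space;
3. `…StubHellingerGaussEquationLpFamily.lean` (this file) — the family as a `C^∞` map into
   `L²(K, ν)` (`ContinuousMap.toLp ∘ curry`, §A, normed parameter space), the vector-valued
   manifold derivative read in a chart (§B), and for a family `θ : W → (N → ℝ)` parametrised by a
   5-manifold `W`: the Hellinger-type map `w ↦ [θ w] ∈ L²(N, μ)` is `C^∞` with differential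
   `X ↦ [D1 θ w X]` (`contMDiff_toLp_family`, `mvfderiv_toLp_family`), the ambient derivative of
   the canonical extension of a tangent vector read in the chart (`mvfderiv_toLp_family_extend`)
   and its derivative `[D2 θ w B A]` (`mvfderiv_extend_toLp_family`), and `L²` inner products of
   continuous representatives as integrals (`inner_toLp_toLp`, §A);
4. `…StubHellingerGaussEquation.lean` — the registered stub.
Authorship: stub-worker of the line lead prover-line-stmt-SmoothPoincare4-6014-c5-0 (wave 1),
continuing the split registered by lead c3.

References: J. Dieudonné, *Foundations of Modern Analysis* (1960), (8.11.2); S. Lang, *Real and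
Functional Analysis*, XIII §8; J. M. Lee, *Introduction to Riemannian Manifolds* (2nd ed. 2018),
Ch. 8; D. Groisser, M. K. Murray, dg-ga/9611008, §2.
-/

noncomputable section

-- the prescribed namespace `Summit.<P>.<Sub>.…` duplicates `SmoothPoincare4` (P = Sub)
set_option linter.dupNamespace false

open scoped Manifold ContDiff Topology ENNReal NNReal RealInnerProductSpace
open Set Function MeasureTheory Topology Filter Bundle

namespace Summit.SmoothPoincare4.SmoothPoincare4.Cruxes.AhHadamardFilling.FisherSphereGauss

open Literature.Geometry.Lorentzian (PseudoRiemannianMetric riemannianMeasure mvfderiv_congr_nhds)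

/-! ## §A. Families of functions as maps into `L²(K, ν)` (normed parameter space) -/

section LpCurry

variable {K : Type*} [TopologicalSpace K] [CompactSpace K]
  {P : Type*} [NormedAddCommGroup P] [NormedSpace ℝ P] [FiniteDimensional ℝ P]
  {EK : Type*} [NormedAddCommGroup EK] [NormedSpace ℝ EK] {HK : Type*} [TopologicalSpace HK]
  {IK : ModelWithCorners ℝ EK HK} [ChartedSpace HK K] [IsManifold IK ∞ K] [MeasurableSpace K]
  [BorelSpace K] {ν : Measure K} [IsFiniteMeasure ν]

/-- **Derivative of a jointly smooth family as an `L²`-valued map.** If `f : P → K → ℝ` is jointly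
`C^∞` at the points of `{p} × K` for `p` near `p₀` (`K` a compact manifold with a finite Borel
measure `ν`, `P` finite-dimensional) and `F : P → C(K, ℝ)` agrees with `f` near `p₀`, then
`p ↦ [F p] ∈ L²(K, ν)` has Fréchet derivative `X ↦ [x ↦ ∂₁f(p₀, x) X]` at `p₀` (the curried
derivative `hasFDerivAt_curry_family` composed with the continuous linear map
`ContinuousMap.toLp`; Dieudonné (8.11.2)). [folklore] -/
theorem hasFDerivAt_toLp_family {f : P → K → ℝ} {F : P → C(K, ℝ)} {p₀ : P}
    (hf : ∀ᶠ p in 𝓝 p₀, ∀ x, ContMDiffAt (𝓘(ℝ, P).prod IK) 𝓘(ℝ, ℝ) ∞ (uncurry f) (p, x))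
    (hF : ∀ᶠ p in 𝓝 p₀, ∀ x, F p x = f p x) :
    ∃ L : P →L[ℝ] C(K, ℝ), (∀ X x, L X x = fderiv ℝ (fun p ↦ f p x) p₀ X) ∧
      HasFDerivAt (fun p ↦ ContinuousMap.toLp (E := ℝ) 2 ν ℝ (F p))
        ((ContinuousMap.toLp (E := ℝ) 2 ν ℝ).comp L) p₀ := by
  obtain ⟨L, hL, h⟩ := hasFDerivAt_curry_family hf hF
  exact ⟨L, hL, (ContinuousMap.toLp (E := ℝ) 2 ν ℝ).hasFDerivAt.comp p₀ h⟩

/-- **Smoothness of a jointly smooth family as an `L²`-valued map.** If `f : P → K → ℝ` is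
jointly `C^∞` at every point of `S × K` (`S ⊆ P` open) and `F : P → C(K, ℝ)` agrees with `f`
on `S`, then `p ↦ [F p] ∈ L²(K, ν)` is `C^∞` on `S` (`contDiffOn_curry_family` composed with
`ContinuousMap.toLp`). [folklore] -/
theorem contDiffOn_toLp_family {S : Set P} (hS : IsOpen S) {f : P → K → ℝ} {F : P → C(K, ℝ)}
    (hf : ∀ p ∈ S, ∀ x, ContMDiffAt (𝓘(ℝ, P).prod IK) 𝓘(ℝ, ℝ) ∞ (uncurry f) (p, x))
    (hF : ∀ p ∈ S, ∀ x, F p x = f p x) :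
    ContDiffOn ℝ ∞ (fun p ↦ ContinuousMap.toLp (E := ℝ) 2 ν ℝ (F p)) S :=
  (ContinuousMap.toLp (E := ℝ) 2 ν ℝ).contDiff.comp_contDiffOn (contDiffOn_curry_family hS hf hF)

omit [FiniteDimensional ℝ P] [ChartedSpace HK K] [IsManifold IK ∞ K] in
/-- **`L²` inner products of continuous representatives are integrals**:
`⟪[F], [G]⟫_{L²(ν)} = ∫ F · G dν` (`MeasureTheory.L2.inner_def` and `ContinuousMap.coeFn_toLp`).
[folklore] -/
theorem inner_toLp_toLp (F G : C(K, ℝ)) :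
    ⟪ContinuousMap.toLp (E := ℝ) 2 ν ℝ F, ContinuousMap.toLp (E := ℝ) 2 ν ℝ G⟫ =
      ∫ x, F x * G x ∂ν := by
  rw [MeasureTheory.L2.inner_def]
  refine integral_congr_ae ?_
  filter_upwards [ContinuousMap.coeFn_toLp (E := ℝ) (p := 2) (𝕜 := ℝ) ν F,
    ContinuousMap.coeFn_toLp (E := ℝ) (p := 2) (𝕜 := ℝ) ν G] with x hF hG
  rw [hF, hG, Real.inner_apply]

end LpCurry

/-! ## §B. The vector-valued manifold derivative read in a chart -/

section Chart

variable {P : Type*} [NormedAddCommGroup P] [NormedSpace ℝ P] {M : Type*} [TopologicalSpace M]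
  [ChartedSpace P M] {V : Type*} [NormedAddCommGroup V] [NormedSpace ℝ V]

/-- **The manifold derivative of a vector-valued map through a chart.** On a manifold modelled
on the vector space `P` itself (boundaryless), if `f : M → V` agrees near `x` with `Φ ∘ φ_x`
(`φ_x` the extended chart at `x`) and `Φ` has Fréchet derivative `L` at `φ_x x`, then
`mvfderiv f x = L` (chain rule and `mfderiv_extChartAt_self`). [folklore] -/
theorem mvfderiv_eq_of_hasFDerivAt_chart [IsManifold 𝓘(ℝ, P) 1 M] {f : M → V} {x : M}
    {Φ : P → V} {L : P →L[ℝ] V} (hΦ : HasFDerivAt Φ L (extChartAt 𝓘(ℝ, P) x x))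
    (hf : f =ᶠ[𝓝 x] fun y ↦ Φ (extChartAt 𝓘(ℝ, P) x y)) (v : P) :
    mvfderiv 𝓘(ℝ, P) f x v = L v := by
  rw [mvfderiv_congr_nhds hf]
  have hΦm : MDifferentiableAt 𝓘(ℝ, P) 𝓘(ℝ, V) Φ (extChartAt 𝓘(ℝ, P) x x) :=
    hΦ.differentiableAt.mdifferentiableAt
  have hφm : MDifferentiableAt 𝓘(ℝ, P) 𝓘(ℝ, P) (extChartAt 𝓘(ℝ, P) x) x :=
    mdifferentiableAt_extChartAt (mem_chart_source P x)
  have key : mfderiv 𝓘(ℝ, P) 𝓘(ℝ, V) (Φ ∘ extChartAt 𝓘(ℝ, P) x) x v = L v := by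
    rw [mfderiv_comp x hΦm hφm]
    change mfderiv 𝓘(ℝ, P) 𝓘(ℝ, V) Φ (extChartAt 𝓘(ℝ, P) x x)
      (mfderiv 𝓘(ℝ, P) 𝓘(ℝ, P) (extChartAt 𝓘(ℝ, P) x) x v) = L v
    rw [mfderiv_extChartAt_self, mfderiv_eq_fderiv, hΦ.fderiv]
    rfl
  change ((NormedSpace.fromTangentSpace _).toContinuousLinearMap ∘L
    mfderiv 𝓘(ℝ, P) 𝓘(ℝ, V) (Φ ∘ extChartAt 𝓘(ℝ, P) x) x) v = L v
  rw [ContinuousLinearMap.comp_apply, key]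
  rfl

variable {E : Type*} [NormedAddCommGroup E] [NormedSpace ℝ E] {H : Type*} [TopologicalSpace H]
  {I : ModelWithCorners ℝ E H} {M' : Type*} [TopologicalSpace M'] [ChartedSpace H M']
  [IsManifold I 1 M']

/-- **The canonical extension of a tangent vector, in coordinates.** For `y` in the chart domain
of `x`, the value at `y` of the canonical extension `FiberBundle.extend E X₀` of `X₀ ∈ T_x M` is
the vector whose coordinates in the chart at `x` are those of `X₀`:
`extend E X₀ y = D(φ_y ∘ φ_x⁻¹)(φ_x y) X₀` (`tangentCoordChange`). [folklore] -/
theorem extend_eq_tangentCoordChange {x y : M'} (hy : y ∈ (chartAt H x).source)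
    (X₀ : TangentSpace I x) :
    FiberBundle.extend E X₀ y = tangentCoordChange I x y y X₀ := by
  have hb : y ∈ (trivializationAt E (TangentSpace I) x).baseSet := hy
  have h2 : ((trivializationAt E (TangentSpace I) x) ⟨x, X₀⟩).2 = X₀ := by
    rw [TangentBundle.trivializationAt_apply]
    exact tangentCoordChange_self (mem_extChartAt_source x)
  simp only [FiberBundle.extend]
  rw [h2, ← Trivialization.symmL_apply (R := ℝ) _ hb,
    TangentBundle.symmL_trivializationAt_eq_core hy]
  rfl

end Chart

/-! ## §C. The family `θ : W → (N → ℝ)` as a smooth map `W → L²(N, μ)` -/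

section Hellinger

variable {N : Type*} [TopologicalSpace N] [ChartedSpace (EuclideanSpace ℝ (Fin 4)) N]
  {W : Type*} [TopologicalSpace W] [ChartedSpace (EuclideanSpace ℝ (Fin 5)) W]
  [IsManifold (𝓡 5) ∞ W] [IsManifold (𝓡 4) ∞ N] {θ : W → N → ℝ}

omit [IsManifold (𝓡 5) ∞ W] [IsManifold (𝓡 4) ∞ N] in
/-- Members `θ w` of a jointly smooth family are continuous. [folklore] -/
theorem continuous_family (hθ : ContMDiff ((𝓡 5).prod (𝓡 4)) 𝓘(ℝ, ℝ) ∞ (fun p : W × N ↦ θ p.1 p.2))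
    (w : W) : Continuous (θ w) :=
  hθ.continuous.comp (continuous_const.prodMk continuous_id)

omit [IsManifold (𝓡 4) ∞ N] in
/-- The chart representative of a jointly smooth family is jointly smooth at the points of
`{z} × N` for `z` near `φ_w w`. [folklore] -/
theorem eventually_contMDiffAt_chartFamily
    (hθ : ContMDiff ((𝓡 5).prod (𝓡 4)) 𝓘(ℝ, ℝ) ∞ (fun p : W × N ↦ θ p.1 p.2)) (w : W) :
    ∀ᶠ z in 𝓝 (extChartAt (𝓡 5) w w), ∀ x,
      ContMDiffAt (𝓘(ℝ, EuclideanSpace ℝ (Fin 5)).prod (𝓡 4)) 𝓘(ℝ, ℝ) ∞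
        (uncurry (chartFamily θ w)) (z, x) := by
  have hS := isOpen_extChartAt_target (I := 𝓡 5) w
  filter_upwards [hS.mem_nhds (mem_extChartAt_target w)] with z hz x
  exact (contMDiffOn_chartFamily hθ w (z, x) ⟨hz, mem_univ _⟩).contMDiffAt
    ((hS.prod isOpen_univ).mem_nhds ⟨hz, mem_univ _⟩)

/-- The first parameter derivative `x ↦ D1 θ w X x` of a jointly smooth family is continuous.
[folklore] -/
theorem continuous_D1 (hθ : ContMDiff ((𝓡 5).prod (𝓡 4)) 𝓘(ℝ, ℝ) ∞ (fun p : W × N ↦ θ p.1 p.2))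
    (w : W) (X : EuclideanSpace ℝ (Fin 5)) : Continuous fun x ↦ D1 θ w X x :=
  (contMDiff_fibre_slice (isOpen_extChartAt_target w) (contMDiffOn_D1L hθ w)
    (mem_extChartAt_target w)).continuous.clm_apply continuous_const

/-- The parameter differential applied to a fixed vector, `(y, x) ↦ D1L θ w y x B`, is jointly
smooth on `φ_w.target × N`. [folklore] -/
theorem contMDiffOn_D1L_apply
    (hθ : ContMDiff ((𝓡 5).prod (𝓡 4)) 𝓘(ℝ, ℝ) ∞ (fun p : W × N ↦ θ p.1 p.2)) (w : W)
    (B : EuclideanSpace ℝ (Fin 5)) :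
    ContMDiffOn (𝓘(ℝ, EuclideanSpace ℝ (Fin 5)).prod (𝓡 4)) 𝓘(ℝ, ℝ) ∞
      (uncurry fun y x ↦ D1L θ w y x B) ((extChartAt (𝓡 5) w).target ×ˢ univ) :=
  (contMDiffOn_D1L hθ w).clm_apply contMDiffOn_const

/-- The second parameter differential `(y, x) ↦ ∂_y (D1L θ w · x B)(y)` is jointly smooth on
`φ_w.target × N` (`contMDiffOn_fderiv_param`). [folklore] -/
theorem contMDiffOn_fderiv_D1L_apply
    (hθ : ContMDiff ((𝓡 5).prod (𝓡 4)) 𝓘(ℝ, ℝ) ∞ (fun p : W × N ↦ θ p.1 p.2)) (w : W)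
    (B : EuclideanSpace ℝ (Fin 5)) :
    ContMDiffOn (𝓘(ℝ, EuclideanSpace ℝ (Fin 5)).prod (𝓡 4)) 𝓘(ℝ, EuclideanSpace ℝ (Fin 5) →L[ℝ] ℝ) ∞
      (uncurry fun y x ↦ fderiv ℝ (fun y' ↦ D1L θ w y' x B) y)
      ((extChartAt (𝓡 5) w).target ×ˢ univ) :=
  contMDiffOn_fderiv_param (isOpen_extChartAt_target w) (contMDiffOn_D1L_apply hθ w B)
    ENat.coe_top_add_one.le

/-- The second parameter derivative `x ↦ D2 θ w X Y x` of a jointly smooth family is continuous.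
[folklore] -/
theorem continuous_D2 (hθ : ContMDiff ((𝓡 5).prod (𝓡 4)) 𝓘(ℝ, ℝ) ∞ (fun p : W × N ↦ θ p.1 p.2))
    (w : W) (X Y : EuclideanSpace ℝ (Fin 5)) : Continuous fun x ↦ D2 θ w X Y x :=
  (contMDiff_fibre_slice (isOpen_extChartAt_target w) (contMDiffOn_fderiv_D1L_apply hθ w X)
    (mem_extChartAt_target w)).continuous.clm_apply continuous_const

variable [CompactSpace N] [MeasurableSpace N] [BorelSpace N] {μ : Measure N} [IsFiniteMeasure μ]

/-- **The family as a smooth map into `L²(N, μ)`**: for a jointly smooth family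
`θ : W → (N → ℝ)` over a compact manifold `N` with a finite Borel measure `μ`, parametrised by
a 5-manifold `W`, the map `w ↦ [θ w] ∈ L²(N, μ)` is `C^∞` — in the chart at `w₀` it is
`ContinuousMap.toLp ∘ (z ↦ θ ∘ φ_{w₀}⁻¹ z)`, smooth by `contDiffOn_toLp_family`.
[cite: Dieudonne1960, (8.11.2)] -/
theorem contMDiff_toLp_family (hθ : ContMDiff ((𝓡 5).prod (𝓡 4)) 𝓘(ℝ, ℝ) ∞ (fun p : W × N ↦ θ p.1 p.2)) (hθc : ∀ w, Continuous (θ w)) : ContMDiff (𝓡 5) 𝓘(ℝ, Lp ℝ 2 μ) ∞ (fun w ↦ ContinuousMap.toLp (E := ℝ) 2 μ ℝ (⟨θ w, hθc w⟩ : C(N, ℝ))) := by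
  intro w₀
  have hS := isOpen_extChartAt_target (I := 𝓡 5) w₀
  have hrange : range (𝓡 5) = univ := ModelWithCorners.range_eq_univ _
  rw [contMDiffAt_iff_source, hrange, contMDiffWithinAt_univ, contMDiffAt_iff_contDiffAt]
  have h := contDiffOn_toLp_family (ν := μ) hS (f := chartFamily θ w₀)
    (F := fun z ↦ (⟨θ ((extChartAt (𝓡 5) w₀).symm z), hθc _⟩ : C(N, ℝ)))
    (fun z hz x ↦ (contMDiffOn_chartFamily hθ w₀ (z, x) ⟨hz, mem_univ _⟩).contMDiffAt
      ((hS.prod isOpen_univ).mem_nhds ⟨hz, mem_univ _⟩)) (fun z hz x ↦ rfl)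
  exact h.contDiffAt (hS.mem_nhds (mem_extChartAt_target w₀))

/-- **The differential of the family as a map into `L²`** is the class of the first parameter
derivative: `d(w ↦ [θ w])_w X = [x ↦ D1 θ w X x]` (the chart representative has Fréchet
derivative the curried parameter derivative, `hasFDerivAt_toLp_family`, read back through the
chart by `mvfderiv_eq_of_hasFDerivAt_chart`); stated for any continuous representative `D` of
`D1 θ w X` (one exists: `continuous_D1`). [folklore] -/
theorem mvfderiv_toLp_family
    (hθ : ContMDiff ((𝓡 5).prod (𝓡 4)) 𝓘(ℝ, ℝ) ∞ (fun p : W × N ↦ θ p.1 p.2))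
    (hθc : ∀ w, Continuous (θ w)) (w : W) (X : EuclideanSpace ℝ (Fin 5)) {D : C(N, ℝ)}
    (hD : ∀ x, D x = D1 θ w X x) :
    mvfderiv (𝓡 5) (fun w ↦ ContinuousMap.toLp (E := ℝ) 2 μ ℝ (⟨θ w, hθc w⟩ : C(N, ℝ))) w X =
      ContinuousMap.toLp (E := ℝ) 2 μ ℝ D := by
  obtain ⟨L, hL, hFL⟩ := hasFDerivAt_toLp_family (ν := μ)
    (F := fun z ↦ (⟨θ ((extChartAt (𝓡 5) w).symm z), hθc _⟩ : C(N, ℝ)))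
    (eventually_contMDiffAt_chartFamily hθ w) (Eventually.of_forall fun z x ↦ rfl)
  have hev : (fun w ↦ ContinuousMap.toLp (E := ℝ) 2 μ ℝ (⟨θ w, hθc w⟩ : C(N, ℝ))) =ᶠ[𝓝 w]
      fun y ↦ ContinuousMap.toLp (E := ℝ) 2 μ ℝ
        (⟨θ ((extChartAt (𝓡 5) w).symm (extChartAt (𝓡 5) w y)), hθc _⟩ : C(N, ℝ)) := by
    filter_upwards [extChartAt_source_mem_nhds (I := 𝓡 5) w] with y hy
    rw [(extChartAt (𝓡 5) w).left_inv hy]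
  rw [mvfderiv_eq_of_hasFDerivAt_chart hFL hev X, ContinuousLinearMap.comp_apply]
  congr 1
  ext x
  rw [hL, hD]
  rfl

/-- **The ambient derivative along the canonical extension, in the chart.** For `y` in the
chart domain of `w` and `B ∈ T_w W`, `d[θ]_y (extend B y) = [x ↦ D1L θ w (φ_w y) x B]`: the
extension has chart-`w` coordinates `B` (`extend_eq_tangentCoordChange`) and the chain rule
`D1L_comp_coordChange` converts the chart-`y` differential into the chart-`w` one; stated for
any continuous representative `D`. [folklore] -/
theorem mvfderiv_toLp_family_extend
    (hθ : ContMDiff ((𝓡 5).prod (𝓡 4)) 𝓘(ℝ, ℝ) ∞ (fun p : W × N ↦ θ p.1 p.2))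
    (hθc : ∀ w, Continuous (θ w)) {w y : W}
    (hy : y ∈ (chartAt (EuclideanSpace ℝ (Fin 5)) w).source) (B : TangentSpace (𝓡 5) w)
    {D : C(N, ℝ)} (hD : ∀ x, D x = D1L θ w (extChartAt (𝓡 5) w y) x B) :
    mvfderiv (𝓡 5) (fun w ↦ ContinuousMap.toLp (E := ℝ) 2 μ ℝ (⟨θ w, hθc w⟩ : C(N, ℝ))) y
        (FiberBundle.extend (EuclideanSpace ℝ (Fin 5)) B y) =
      ContinuousMap.toLp (E := ℝ) 2 μ ℝ D := by
  refine mvfderiv_toLp_family hθ hθc y _ fun x ↦ ?_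
  rw [hD, extend_eq_tangentCoordChange hy, ← D1L_comp_coordChange hθ hy x]
  rfl

/-- **The derivative of the ambient derivative along a canonical extension** is the class of the
chart Hessian: `d(y ↦ d[θ]_y (extend B y))_w A = [x ↦ D2 θ w B A x]` — by
`mvfderiv_toLp_family_extend` the field reads `z ↦ [x ↦ ∂_z(θ∘φ_w⁻¹)(·)(x) B]` in the chart at
`w`, a jointly smooth family whose curried derivative at `φ_w w` along `A` is `[D2 θ w B A]`
(`hasFDerivAt_toLp_family`); stated for any continuous representative `D` of `D2 θ w B A`
(one exists: `continuous_D2`). [folklore] -/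
theorem mvfderiv_extend_toLp_family
    (hθ : ContMDiff ((𝓡 5).prod (𝓡 4)) 𝓘(ℝ, ℝ) ∞ (fun p : W × N ↦ θ p.1 p.2))
    (hθc : ∀ w, Continuous (θ w)) (w : W) (A B : TangentSpace (𝓡 5) w) {D : C(N, ℝ)}
    (hD : ∀ x, D x = D2 θ w B A x) :
    mvfderiv (𝓡 5) (fun y ↦ mvfderiv (𝓡 5)
        (fun w ↦ ContinuousMap.toLp (E := ℝ) 2 μ ℝ (⟨θ w, hθc w⟩ : C(N, ℝ))) y
          (FiberBundle.extend (EuclideanSpace ℝ (Fin 5)) B y)) w A =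
      ContinuousMap.toLp (E := ℝ) 2 μ ℝ D := by
  classical
  have hS := isOpen_extChartAt_target (I := 𝓡 5) w
  have hsm := contMDiffOn_D1L_apply hθ w B
  -- continuous representatives of the field read in the chart at `w`
  have hc : ∀ z ∈ (extChartAt (𝓡 5) w).target, Continuous fun x ↦ D1L θ w z x B := fun z hz ↦
    (contMDiff_fibre_slice hS hsm hz).continuous
  obtain ⟨F, hFdef⟩ : ∃ F : EuclideanSpace ℝ (Fin 5) → C(N, ℝ), F = fun z ↦
      if hz : z ∈ (extChartAt (𝓡 5) w).target then ⟨fun x ↦ D1L θ w z x B, hc z hz⟩ else 0 :=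
    ⟨_, rfl⟩
  have hFapp : ∀ z, z ∈ (extChartAt (𝓡 5) w).target → ∀ x, F z x = D1L θ w z x B := by
    intro z hz x
    simp only [hFdef, dif_pos hz, ContinuousMap.coe_mk]
  have hf : ∀ᶠ z in 𝓝 (extChartAt (𝓡 5) w w), ∀ x,
      ContMDiffAt (𝓘(ℝ, EuclideanSpace ℝ (Fin 5)).prod (𝓡 4)) 𝓘(ℝ, ℝ) ∞
        (uncurry fun y x ↦ D1L θ w y x B) (z, x) := by
    filter_upwards [hS.mem_nhds (mem_extChartAt_target w)] with z hz x
    exact (hsm (z, x) ⟨hz, mem_univ _⟩).contMDiffAt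
      ((hS.prod isOpen_univ).mem_nhds ⟨hz, mem_univ _⟩)
  have hF : ∀ᶠ z in 𝓝 (extChartAt (𝓡 5) w w), ∀ x, F z x = (fun y x ↦ D1L θ w y x B) z x := by
    filter_upwards [hS.mem_nhds (mem_extChartAt_target w)] with z hz x
    exact hFapp z hz x
  obtain ⟨L, hL, hFL⟩ := hasFDerivAt_toLp_family (ν := μ) hf hF
  have hev : (fun y ↦ mvfderiv (𝓡 5)
      (fun w ↦ ContinuousMap.toLp (E := ℝ) 2 μ ℝ (⟨θ w, hθc w⟩ : C(N, ℝ))) y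
        (FiberBundle.extend (EuclideanSpace ℝ (Fin 5)) B y)) =ᶠ[𝓝 w]
      fun y ↦ ContinuousMap.toLp (E := ℝ) 2 μ ℝ (F (extChartAt (𝓡 5) w y)) := by
    filter_upwards [chart_source_mem_nhds (EuclideanSpace ℝ (Fin 5)) w] with y hy
    have hy' : extChartAt (𝓡 5) w y ∈ (extChartAt (𝓡 5) w).target :=
      (extChartAt (𝓡 5) w).map_source (by rwa [extChartAt_source])
    exact mvfderiv_toLp_family_extend hθ hθc hy B (hFapp _ hy')
  rw [mvfderiv_eq_of_hasFDerivAt_chart hFL hev A, ContinuousLinearMap.comp_apply]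
  congr 1
  ext x
  rw [hL, hD]
  rfl

end Hellinger

end Summit.SmoothPoincare4.SmoothPoincare4.Cruxes.AhHadamardFilling.FisherSphereGauss

end
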